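import Summits.ResolutionOfSingularities.ResolutionOfSingularities.Theorems.PurelyInseparableDim4JointWaitingKid
import Summits.ResolutionOfSingularities.ResolutionOfSingularities.Theorems.PurelyInseparableDim4ChartRootPoint
import Summits.ResolutionOfSingularities.ResolutionOfSingularities.Theorems.PurelyInseparableDim4PointLastStep
import Summits.ResolutionOfSingularities.ResolutionOfSingularities.Theorems.PurelyInseparableDim4JointTreeRoot
import HarnessLib

/-!
# Purely inseparable four-folds: the WAITING KID COVERS the order-`p` points over the waiting member off the host
# (brick S3 (c) «joint point∘coordinate chains», part 36 = v3-lite cover off the host; cell `res-dim4-pi`)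

[OURS · counted 0] (D-0157 DOOR 2; desk WORD #66 (4)(c), #74 (g), #99 (d); frame `PIDim4.TerminationImpliesOrderReduction`,
S3 (c) v3-lite, memo `S3c-V3-DESIGN.md` Addenda 2–4; host item stmt-ResolutionOfSingularities-16155, helper). Nothing here
proves resolution of singularities in dimension ≥ 4 / characteristic `p` — NOT here, not anywhere in this programme.

After blowing up the host `V(z, x_S)`, the closed order-`p` points of the new stage OFF the exceptional divisor are the
preimages of the old order-`p` points off the host; those lying over a waiting member `W = V(z, x_i − c_i : i ∈ T)`
(`c|_S = 0`, `S ∖ {j} ⊆ T`, `j ∉ T`) must be shown to lie on the waiting kid `T_B(j, c, T)` of part 35 — this is the new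
half of the COVER clause of the node with waiting members (the half over the host is part 19's). PROVED here:

* §1 `φ_ψ_base_of_model` — bookkeeping through the comparison square: for `w` over the host chart, the base point
  `q = e₁⁻¹((π|) w)` has `φ q = π w` and `ψ q = B(ι(ε w))`;
* §2 **`model_mem_image_CΛ_of_coords`** — MODEL: a closed point `w₀` of the model blow-up `B` with
  `ord_{w₀}(transform) ≥ p`, `B w₀ ∉ V(z, x_S)` and `xᵢ − cᵢ ∈ 𝔭_{B w₀}` (`i ∈ T`) lies in `T_B(j, c, T)`: its base point
  `(a, b′)` has `b′|_T = c|_T`, hence `b′|_{S ∖ j} = 0`, so `b′_j ≠ 0` (else `a^p = −F(b′) = 0` and `B w₀` would be on the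
  centre); part 34's `eq_chartImm_of_B_eq_pt` puts `w₀` in the `x_j`-chart with fibre coordinates `b′ᵢ/b′_j = 0 = cᵢ` on
  `S ∖ j` and `b′ᵢ = cᵢ` off `S`, and typ-2's `chartImm_mem_image_CΛ_chart_iff` concludes;
* §3 **`ιε_mem_image_CΛ_of_off_host`** — the same through the shared `ε` for ANY blowing up `π : W → Z` of the host
  member seen through a zigzag chart: a closed order-`p` point `w ∈ W` with `π w ∉ host` and
  `π w ∈ φ(ψ⁻¹{xᵢ − cᵢ ∈ 𝔭 (i ∈ T)})` has `ι(ε w) ∈ T_B(j, c, T)` — with part 35's model description, `w` lies on the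
  waiting kid.

AI-produced formalisation, weaker than expert review. bears_on: LADDER-RESOLUTION:D157-DOOR2 (res-dim4-pi · S3 (c) joint
v3-lite).
-/

set_option linter.dupNamespace false -- D-0017: single-problem summit path `Summit.<S>.<S>.…` by design

noncomputable section

open MvPolynomial Finset CategoryTheory AlgebraicGeometry Opposite TopologicalSpace
open AlgebraicGeometry.Scheme.IdealSheafData (ofIdealTop vanishingIdeal)

namespace Summit.ResolutionOfSingularities.ResolutionOfSingularities.Theorems.PIDim4

open Literature.AlgebraicGeometry.Resolution
open Literature.AlgebraicGeometry.Resolution.Hauser2010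
open Literature.AlgebraicGeometry.Resolution.AffinePointBlowup (P A γ coord Wtop ξ)

namespace Equimultiple

/-! ## §1 The base point of a point over the host chart -/

section Base

variable {K : Type} [Field K] {Z Y W Bl : Scheme.{0}} (φ : Y ⟶ Z) [IsOpenImmersion φ] (ψ : Y ⟶ P 4 K)
  [IsOpenImmersion ψ] {π : W ⟶ Z} {B : Bl ⟶ P 4 K}
  (ε : (π ⁻¹ᵁ φ.opensRange : Scheme.{0}) ≅ (B ⁻¹ᵁ ψ.opensRange : Scheme.{0}))

/-- **The base point of a point over the host chart**: for `w ∈ π⁻¹ φ(Y)` the point `q = e₁⁻¹((π|) w)` of `Y` has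
`φ q = π w` and `ψ q = B(ι(ε w))` (the comparison square). [cite: GortzWedhorn2020, Prop. 13.91] -/
theorem φ_ψ_base_of_model
    (hsq : ε.hom ≫ (B ∣_ ψ.opensRange) = (π ∣_ φ.opensRange) ≫ (φ.isoOpensRange.inv ≫ ψ.isoOpensRange.hom))
    {w : W} (hwV : w ∈ π ⁻¹ᵁ φ.opensRange) :
    φ (φ.isoOpensRange.inv ((π ∣_ φ.opensRange) ⟨w, hwV⟩)) = π w ∧
      ψ (φ.isoOpensRange.inv ((π ∣_ φ.opensRange) ⟨w, hwV⟩)) =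
        B ((B ⁻¹ᵁ ψ.opensRange).ι (ε.hom ⟨w, hwV⟩)) := by
  have he₁ι : φ.isoOpensRange.hom ≫ φ.opensRange.ι = φ := Scheme.Hom.isoOpensRange_hom_ι φ
  have he₂ι : ψ.isoOpensRange.hom ≫ ψ.opensRange.ι = ψ := Scheme.Hom.isoOpensRange_hom_ι ψ
  have he₁ι' : φ.isoOpensRange.inv ≫ φ = φ.opensRange.ι := by rw [Iso.inv_comp_eq, he₁ι]
  have he₂ι' : ψ.isoOpensRange.inv ≫ ψ = ψ.opensRange.ι := by rw [Iso.inv_comp_eq, he₂ι]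
  constructor
  · rw [← Scheme.Hom.comp_apply _ φ, he₁ι', ← Scheme.Hom.comp_apply, morphismRestrict_ι, Scheme.Hom.comp_apply]
    rfl
  · have h1 : ψ.isoOpensRange.hom (φ.isoOpensRange.inv ((π ∣_ φ.opensRange) ⟨w, hwV⟩)) =
        (B ∣_ ψ.opensRange) (ε.hom ⟨w, hwV⟩) := by
      rw [← Scheme.Hom.comp_apply, ← Scheme.Hom.comp_apply, ← hsq, Scheme.Hom.comp_apply]
    have ha : ∀ q : Y, ψ.isoOpensRange.inv (ψ.isoOpensRange.hom q) = q := fun q => by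
      rw [← Scheme.Hom.comp_apply, Iso.hom_inv_id]; rfl
    rw [← ha (φ.isoOpensRange.inv ((π ∣_ φ.opensRange) ⟨w, hwV⟩)), h1, ← Scheme.Hom.comp_apply _ ψ, he₂ι',
      Scheme.Opens.ι_apply, morphismRestrict_base_coe, Scheme.Opens.ι_apply]

end Base

/-! ## §2 Model: a point off the centre with the waiting coordinates lies on the waiting kid -/

section Model

variable {K : Type} [Field K] {p : ℕ} [hp : Fact p.Prime] [CharP K p]
  {Bl : Scheme.{0}} {B : Bl ⟶ P 4 K} {S T : Finset (Fin 4)} {j : Fin 4}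

/-- **MODEL COVER OFF THE HOST.** `B` any blowing up of `𝔸⁵` along `V(z, x_S)` (`S` permissible for `s.F`), `(j, c, T)` a
waiting entry (`j ∈ S`, `c_j = 0`, `c|_S = 0`, `S ∖ {j} ⊆ T`, `j ∉ T`) with re-centring `Θ` reading the model transform `J` as
`(z^p + G)·𝒪` on the `x_j`-chart, `T` permissible for `G`. A CLOSED point `w₀` of the model with `ord_{w₀} J ≥ p`, NOT over the
centre, and with `xᵢ − cᵢ ∈ 𝔭_{B w₀}` for `i ∈ T`, lies on the chart-centre `T_B(j, c, T) = (Spec Θ ≫ chartImm_j)(V(z, x_T))`.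
[cite: Hauser2010, §G (strict transform in the chart expression)] [cite: GortzWedhorn2020, Prop. 13.91 (3)] -/
theorem model_mem_image_CΛ_of_coords [IsAlgClosed K]
    (hB : IsBlowup B (AffineCoordBlowup.𝓘Λ 4 K (insert 0 (Fin.succ '' (S : Set (Fin 4))))))
    (s : State K) (hperm : (p : ℕ∞) ≤ CentreBlowup.ordAlong S s.F)
    (hj : j ∈ S) {c : Fin 4 → K} (hcS : ∀ i ∈ S, c i = 0) (hsub : S.erase j ⊆ T) (hjT : j ∉ T)
    {Θ : A 4 K ≃ₐ[K] A 4 K} (hs : ∀ i : Fin 4, Θ (X i.succ) = X i.succ + C (c i)) {G : MvPolynomial (Fin 4) K}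
    (hG : (p : ℕ∞) ≤ CentreBlowup.ordAlong T G)
    (hread : (controlledTransform B (AffineCoordBlowup.𝓘Λ 4 K (insert 0 (Fin.succ '' (S : Set (Fin 4)))))
        (hypSheaf p s.F) p).comap
        (Spec.map (CommRingCat.ofHom (Θ : A 4 K →+* A 4 K)) ≫
          AffineCoordBlowup.chartImm hB (ChartDictionary.succ_mem_centreVars hj)) = hypSheaf p G)
    {w₀ : Bl} (hw₀ : IsClosed ({w₀} : Set Bl))
    (hord : (p : ℕ∞) ≤ idealOrder (controlledTransform B
      (AffineCoordBlowup.𝓘Λ 4 K (insert 0 (Fin.succ '' (S : Set (Fin 4))))) (hypSheaf p s.F) p) w₀)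
    (hoff : B w₀ ∉ (AffineCoordBlowup.CΛ 4 K (insert 0 (Fin.succ '' (S : Set (Fin 4)))) : Set (P 4 K)))
    (hcoord : ∀ i ∈ T, (X i.succ - C (c i) : A 4 K) ∈ (B w₀).asIdeal) :
    w₀ ∈ (Spec.map (CommRingCat.ofHom (Θ : A 4 K →+* A 4 K)) ≫
        AffineCoordBlowup.chartImm hB (ChartDictionary.succ_mem_centreVars hj)) ''
      (AffineCoordBlowup.CΛ 4 K (insert 0 (Fin.succ '' (T : Set (Fin 4)))) : Set (P 4 K)) := by
  classical
  haveI : PerfectRing K p := PerfectRing.ofSurjective K p fun x => IsAlgClosed.exists_pow_nat_eq x hp.out.pos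
  set J := controlledTransform B (AffineCoordBlowup.𝓘Λ 4 K (insert 0 (Fin.succ '' (S : Set (Fin 4)))))
    (hypSheaf p s.F) p with hJ
  have hsR : ∀ k : Fin 4, (Θ : A 4 K →+* A 4 K) (X k.succ) = X k.succ + C (c k) := fun k => hs k
  -- the base point `x = B w₀ = (a, b')` is closed, off the centre, of order `≥ p` for `z^p + F`
  have hxc : IsClosed ({B w₀} : Set (P 4 K)) := isClosed_singleton_π' hB hw₀
  obtain ⟨a, b', hx⟩ := exists_eq_vanishingIdeal_cons_of_isClosed hxc
  have hb'T : ∀ i ∈ T, b' i = c i := fun i hi => (X_succ_sub_C_mem_asIdeal_iff i (c i) a b' hx).mp (hcoord i hi)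
  have hxC : B w₀ ∉ ((AffineCoordBlowup.𝓘Λ 4 K (insert 0 (Fin.succ '' (S : Set (Fin 4))))).support : Set (P 4 K)) := by
    rw [AffineCoordBlowup.support_𝓘Λ]; exact hoff
  have hordx : (p : ℕ∞) ≤ idealOrder (hypSheaf p s.F) (B w₀) := by
    rw [← idealOrder_controlledTransform_eq_of_eq_of_not_mem_support hB hxC (hypSheaf p s.F) p rfl]
    exact hord
  have hord' := (natCast_le_idealOrder_hypSheaf_iff (p := p) s.F hx p).mp hordx
  rw [natCast_le_ordZero_translate_hyp_iff] at hord'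
  obtain ⟨hab, -⟩ := hord'
  -- `b'_j ≠ 0`: otherwise `b'|_S = 0`, `F(b') = 0`, `a = 0` and `x` would lie on the centre
  have hbj : b' j ≠ 0 := by
    intro h0
    have hbS : ∀ i ∈ S, b' i = 0 := fun i hi => by
      by_cases hij : i = j
      · rw [hij]; exact h0
      · rw [hb'T i (hsub (Finset.mem_erase.mpr ⟨hij, hi⟩))]; exact hcS i hi
    have hF0 : MvPolynomial.eval b' s.F = 0 :=
      eval_eq_zero_of_one_le_ordAlong (le_trans (by exact_mod_cast hp.out.one_lt.le) hperm) hbS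
    rw [hF0, add_zero] at hab
    exact hoff (mem_CΛ_of_cons hx (pow_eq_zero_iff hp.out.ne_zero |>.mp hab) hbS)
  -- the chart point above `x`
  let r : P 4 K := ⟨MvPolynomial.vanishingIdeal K {(Fin.cons (a * (b' j)⁻¹)
    (fun i => if i ∈ S ∧ i ≠ j then b' i * (b' j)⁻¹ else b' i) : Fin (4 + 1) → K)}, inferInstance⟩
  have hr : r.asIdeal = MvPolynomial.vanishingIdeal K {(Fin.cons (a * (b' j)⁻¹)
    (fun i => if i ∈ S ∧ i ≠ j then b' i * (b' j)⁻¹ else b' i) : Fin (4 + 1) → K)} := rfl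
  have hw₀r : w₀ = AffineCoordBlowup.chartImm hB (ChartDictionary.succ_mem_centreVars hj) r :=
    ChartDictionary.eq_chartImm_of_B_eq_pt hB hj a b' hbj hx hr
  rw [hw₀r, ChartDictionary.chartImm_mem_image_CΛ_chart_iff hj hsR hB hp.out.ne_zero hG J hread r]
  refine ⟨?_, fun i hi => ?_⟩
  · -- `r` lies on the transform
    rw [Scheme.IdealSheafData.support_comap]
    change AffineCoordBlowup.chartImm hB (ChartDictionary.succ_mem_centreVars hj) r ∈ (J.support : Set Bl)
    rw [← hw₀r]
    exact (one_le_idealOrder_iff J w₀).mp (le_trans (by exact_mod_cast hp.out.one_lt.le) hord)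
  · -- the fibre coordinates of `r` agree with `c` on `T`
    refine (X_succ_sub_C_mem_asIdeal_iff i (c i) _ _ hr).mpr ?_
    have hij : i ≠ j := fun h => hjT (h ▸ hi)
    by_cases hiS : i ∈ S
    · rw [if_pos ⟨hiS, hij⟩, hb'T i hi, hcS i hiS, zero_mul]
    · rw [if_neg (fun h => hiS h.1), hb'T i hi]

end Model

/-! ## §3 Through the shared `ε` -/

section OffHost

variable {K : Type} [Field K] {p : ℕ} [hp : Fact p.Prime] [CharP K p]
variable {Z Y W Bl : Scheme.{0}} (φ : Y ⟶ Z) [IsOpenImmersion φ] (ψ : Y ⟶ P 4 K) [IsOpenImmersion ψ]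
  {π : W ⟶ Z} {B : Bl ⟶ P 4 K} {S T : Finset (Fin 4)} {j : Fin 4}
  (ε : (π ⁻¹ᵁ φ.opensRange : Scheme.{0}) ≅ (B ⁻¹ᵁ ψ.opensRange : Scheme.{0}))

/-- **THE WAITING KID COVERS THE ORDER-`p` POINTS OVER THE WAITING MEMBER OFF THE HOST** (through the shared `ε`). Host
member of `(Z, M)` (multiplicity `p`) seen through a zigzag chart, `π : W → Z` any blowing up of its centre `Zc`, `B` a model
blowing up of `V(z, x_S)`, `ε` the comparison (`hsq`, `hKEY`); `(j, c, T)` a waiting entry with re-centring `Θ` reading the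
model transform as `(z^p + G)·𝒪`, `T` permissible for `G`. A CLOSED point `w ∈ W` over the chart with
`ord_w (M.transform π Zc) ≥ p`, `π w` NOT on the host member `φ(ψ⁻¹ V(z, x_S))` and `π w ∈ φ(ψ⁻¹{xᵢ − cᵢ ∈ 𝔭 (i ∈ T)})`
has `ι(ε w) ∈ T_B(j, c, T)`; with part 35's model description, `w` lies on the waiting kid.
[cite: Hauser2010, §G] [cite: GortzWedhorn2020, Prop. 13.91] -/
theorem ιε_mem_image_CΛ_of_off_host [IsAlgClosed K] (Zc : Z.IdealSheafData)
    (hB : IsBlowup B (AffineCoordBlowup.𝓘Λ 4 K (insert 0 (Fin.succ '' (S : Set (Fin 4))))))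
    (hsq : ε.hom ≫ (B ∣_ ψ.opensRange) = (π ∣_ φ.opensRange) ≫ (φ.isoOpensRange.inv ≫ ψ.isoOpensRange.hom))
    (M : MarkedIdeal Z) (hmult : M.mult = p) (s : State K)
    (hKEY : ((controlledTransform B (AffineCoordBlowup.𝓘Λ 4 K (insert 0 (Fin.succ '' (S : Set (Fin 4)))))
        (hypSheaf p s.F) p).comap (B ⁻¹ᵁ ψ.opensRange).ι).comap ε.hom =
      (controlledTransform π Zc M.ideal p).comap (π ⁻¹ᵁ φ.opensRange).ι)
    (hperm : (p : ℕ∞) ≤ CentreBlowup.ordAlong S s.F)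
    (hj : j ∈ S) {c : Fin 4 → K} (hcS : ∀ i ∈ S, c i = 0) (hsub : S.erase j ⊆ T) (hjT : j ∉ T)
    {Θ : A 4 K ≃ₐ[K] A 4 K} (hs : ∀ i : Fin 4, Θ (X i.succ) = X i.succ + C (c i)) {G : MvPolynomial (Fin 4) K}
    (hG : (p : ℕ∞) ≤ CentreBlowup.ordAlong T G)
    (hread : (controlledTransform B (AffineCoordBlowup.𝓘Λ 4 K (insert 0 (Fin.succ '' (S : Set (Fin 4)))))
        (hypSheaf p s.F) p).comap
        (Spec.map (CommRingCat.ofHom (Θ : A 4 K →+* A 4 K)) ≫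
          AffineCoordBlowup.chartImm hB (ChartDictionary.succ_mem_centreVars hj)) = hypSheaf p G)
    {w : W} (hw : IsClosed ({w} : Set W)) (hwV : w ∈ π ⁻¹ᵁ φ.opensRange)
    (hord : (p : ℕ∞) ≤ idealOrder (M.transform π Zc).ideal w)
    (hoff : π w ∉ φ '' (ψ ⁻¹' (AffineCoordBlowup.CΛ 4 K (insert 0 (Fin.succ '' (S : Set (Fin 4)))) : Set (P 4 K))))
    (hwT : π w ∈ φ '' (ψ ⁻¹' {x : P 4 K | ∀ i ∈ T, (X i.succ - C (c i) : A 4 K) ∈ x.asIdeal})) :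
    ((B ⁻¹ᵁ ψ.opensRange).ι (ε.hom ⟨w, hwV⟩) : Bl) ∈
      (Spec.map (CommRingCat.ofHom (Θ : A 4 K →+* A 4 K)) ≫
          AffineCoordBlowup.chartImm hB (ChartDictionary.succ_mem_centreVars hj)) ''
        (AffineCoordBlowup.CΛ 4 K (insert 0 (Fin.succ '' (T : Set (Fin 4)))) : Set (P 4 K)) := by
  haveI : IsProper B := hB.isProper
  haveI : IsLocallyNoetherian Bl := LocallyOfFiniteType.isLocallyNoetherian B
  haveI : JacobsonSpace Bl := jacobsonSpace_of_isBlowup' hB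
  set wt : (π ⁻¹ᵁ φ.opensRange : Scheme.{0}) := ⟨w, hwV⟩ with hwt
  set w₀ : Bl := (B ⁻¹ᵁ ψ.opensRange).ι (ε.hom wt) with hw₀
  -- `w₀` is closed
  have hw₀_closed : IsClosed ({w₀} : Set Bl) := by
    have hwt_closed : IsClosed ({wt} : Set (π ⁻¹ᵁ φ.opensRange : Scheme.{0})) :=
      isClosed_singleton_of_isOpenImmersion_eq (π ⁻¹ᵁ φ.opensRange).ι wt hw rfl
    have hz_closed : IsClosed ({ε.hom wt} : Set (B ⁻¹ᵁ ψ.opensRange : Scheme.{0})) := by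
      have h : (ε.inv : (B ⁻¹ᵁ ψ.opensRange : Scheme.{0}) → (π ⁻¹ᵁ φ.opensRange : Scheme.{0})) ⁻¹' {wt} =
          {ε.hom wt} := by
        ext z'
        simp only [Set.mem_preimage, Set.mem_singleton_iff]
        constructor
        · intro hz'
          rw [← hz', ← Scheme.Hom.comp_apply, Iso.inv_hom_id]
          rfl
        · intro hz'
          rw [hz', ← Scheme.Hom.comp_apply, Iso.hom_inv_id]
          rfl
      rw [← h]
      exact hwt_closed.preimage ε.inv.continuous
    apply isClosed_singleton_of_isLocallyClosed_singleton
    rw [hw₀, ← Set.image_singleton]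
    exact hz_closed.isLocallyClosed.image (B ⁻¹ᵁ ψ.opensRange).ι.isOpenEmbedding.isInducing
      (B ⁻¹ᵁ ψ.opensRange).ι.isOpenEmbedding.isOpen_range.isLocallyClosed
  -- its order for the model transform
  have hord₀ : (p : ℕ∞) ≤ idealOrder (controlledTransform B
      (AffineCoordBlowup.𝓘Λ 4 K (insert 0 (Fin.succ '' (S : Set (Fin 4))))) (hypSheaf p s.F) p) w₀ := by
    have hιwt : (π ⁻¹ᵁ φ.opensRange).ι wt = w := rfl
    have h := hord
    rw [MarkedIdeal.transform_ideal, hmult, ← hιwt, ← idealOrder_comap_of_isOpenImmersion (π ⁻¹ᵁ φ.opensRange).ι,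
      ← hKEY, idealOrder_comap_of_isOpenImmersion ε.hom,
      idealOrder_comap_of_isOpenImmersion (B ⁻¹ᵁ ψ.opensRange).ι] at h
    rw [hw₀]
    exact h
  -- its base point, through the square
  obtain ⟨hφq, hψq⟩ := φ_ψ_base_of_model φ ψ ε hsq hwV
  set q := φ.isoOpensRange.inv ((π ∣_ φ.opensRange) ⟨w, hwV⟩) with hq
  have hBw₀ : B w₀ = ψ q := by rw [hw₀, hwt, ← hψq]
  have hoff₀ : B w₀ ∉ (AffineCoordBlowup.CΛ 4 K (insert 0 (Fin.succ '' (S : Set (Fin 4)))) : Set (P 4 K)) := by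
    intro h
    exact hoff ⟨q, by rw [Set.mem_preimage, ← hBw₀]; exact h, hφq⟩
  have hcoord₀ : ∀ i ∈ T, (X i.succ - C (c i) : A 4 K) ∈ (B w₀).asIdeal := by
    obtain ⟨q', hq', hq'w⟩ := hwT
    have hqq : q' = q := φ.isOpenEmbedding.injective (hq'w.trans hφq.symm)
    rw [hBw₀, ← hqq]
    exact hq'
  exact model_mem_image_CΛ_of_coords hB s hperm hj hcS hsub hjT hs hG hread hw₀_closed hord₀ hoff₀ hcoord₀

end OffHost

end Equimultiple

end Summit.ResolutionOfSingularities.ResolutionOfSingularities.Theorems.PIDim4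

end
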